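import Summits.BirchSwinnertonDyer.Rank1Residual.X1.RankOneLeadingTermSqueeze
import Summits.BirchSwinnertonDyer.Rank1Residual.X2.IsogenyLambdaInvariant
import HarnessLib

/-!
# Route N at RANK ONE on class X1 — the factor pattern of `P_an/T` with the ODD-parity squeeze;
# route E fed by route D and by an isogenous member

HONEST FRAMING (cell `b2b-bsdres`, run/shared/lean/b2b/bsd-rank1-residual/, verbatim in every
file): the goal of the cell is to DELETE the COMBINATION-SHAPED residual classes of the
Birch–Swinnerton-Dyer formula for ALL analytic-rank `≤ 1` elliptic curves over `ℚ` — "full BSD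
formula for every rank `≤ 1` curve in class `C`" assembled STRICTLY from published theorems — so
that the rank-`≤ 1` remainder becomes exactly the CONSTRUCTION-SHAPED classes, which are TYPED
(missing-input `Prop`s), NOT attempted. This is not "finishing BSD". Unit `b2b-bsdres-x1a` (X1 prover
A; CLASS-OWNERS row "X1 (r = 1)"), gen 15: research route; NO CLAIM BEYOND STATED CLASSES; nothing
here changes a label; no new named fact. ONE typed def (`AnalyticLamDivisorSetT W p A`: "the `λ` of
every `Λ`-divisor of `ϖ·L_p(E,T)` VANISHING AT `T = 0` lies in `A`", nothing asserted — the rank-one twin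
of sub-cell eisenstein-p1's `AnalyticLamDivisorSet`); everything else is a theorem over PUBLISHED named
facts and the cell's typed per-pair inputs.

WHY THIS FILE. Sub-cell eisenstein-p1's ROUTE N (`X1/FactorSqueeze.lean`, gen 10; X1R0-GAPMAP §19):
by Weierstrass preparation and unique factorisation, `λ(f_E)` is a subset sum of the `ℚ_p`-irreducible
factor degrees of the distinguished polynomial `P_an` of `ϖ·L_p` — a finite `p`-adic computation on its
first `λ_an + 1` coefficients (Newton polygon + Ore residual polynomials, two engines), typed as
`AnalyticLamDivisorSet W p A`; with parity and a lower bound it squeezes `λ(f_E) = λ_an`. eisenstein-p1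
handed the rank-one case to x1a (§19.5 V51, §19.6 (3)). AT RANK ONE `P_an = T·P'` (`L(E,1) = 0`) and
`T ∣ f_E` (Perrin-Riou–Schneider, BMS Thm. 1.7 (1): `ord_{T=0} f_E ≥ rank E(ℚ) = 1`;
`RankOneLeadingTermSqueeze.constantCoeff_charGenerator_eq_zero`), so the distinguished polynomial of
`f_E` is `T·Q` with `Q ∣ P'` and `λ(f_E) − 1` is a subset sum of the factor degrees of `P'` ALONE — a
sharper certificate than `A` (it discards the odd sums not using the factor `T`): typed
`AnalyticLamDivisorSetT W p A` (§1), discharged in the kernel when `P'` is EISENSTEIN (`ord_p c₁ = 1`: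
`A = {1, λ_an}`, §1, from `X1/RankOneLeadingTermSqueeze.lean` §1). THE SQUEEZE (§2, PROVED): `λ(f_E) ∈ A`,
`λ(f_E)` ODD (Greenberg Prop. 3.10 at Selmer corank `1`), `λ(f_E·h) = n` odd, `λ(f_E) ≥ k`; if
`∀ d ∈ A, Odd d → k ≤ d → n ≤ d + 1` then `λ(h) = 0`: the λ-part; with the μ-part (`μ_an = 0`), Mazur's
main conjecture; on the rank-one leaf (§3) + the Schneider certificate ⇒ `BSD(E,p)`. §4 carries route E
(`ord_p c₁ = 1`) fed by route D's `ResidualDescentBound` and by `λ_alg ≥ 2` at an ISOGENOUS member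
(`λ` is an isogeny invariant — KERNEL theorem `X2/IsogenyLambdaInvariant.lean`, sub-cell eisenstein-p2).

* §1 `AnalyticLamDivisorSetT` (TYPED), `.mono`, `.of_lamDivisorSet`,
  `analyticLamDivisorSetT_pair_of_coeffOneVal_one` (Eisenstein `P'` ⇒ `A = {1, n}`, PROVED).
* §2 `lambdaPartAt_of_lamDivisorSetT_of_odd` (+ `_of_residualDescent`).
* §3 `RankOne.Leaf.mazurMainConjecture_of_muZero_of_lamDivisorSetT` (+ `_of_residualDescent`,
  `…_and_bsdp_…_of_coeff_one_ne_zero`), consistency `RankOne.Leaf.exists_mem_of_lamDivisorSetT`.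
* §4 `RankOne.Leaf.mazurMainConjecture_and_bsdp_of_coeffOneVal_one_of_residualDescent`,
  `…_of_isIsogenous`.

References: [Washington1997] Thm. 7.3, Prop. 7.6; [GreenbergLNM1716] Prop. 3.10, §5 p. 131;
[Wuthrich2014] Thm. 16; [BalakrishnanMullerStein2015] Thm. 1.7; [GreenbergVatsal2000] §2 pp. 25–28;
[PerrinRiou1987] §1.4; HOME/b2b-bsdres-eisenstein-p1/X1R0-GAPMAP.md §19; HOME/b2b-bsdres-x1a/X1-CHAIN.md §24.
-/

noncomputable section

open scoped Classical MatrixGroups ModularForm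

open PowerSeries CongruenceSubgroup WeierstrassCurve Literature.NumberTheory.EllipticCurves
  Literature.NumberTheory.EllipticCurves.ModularForms
  Literature.NumberTheory.EllipticCurves.Wuthrich2014
  Literature.NumberTheory.EllipticCurves.Rank1Residual
  Literature.NumberTheory.EllipticCurves.Greenberg1999
  Summit.BirchSwinnertonDyer.BirchSwinnertonDyer.Theorems
  Summit.BirchSwinnertonDyer.BirchSwinnertonDyer.Theorems.Rank1ResidualX1Defs
  Summit.BirchSwinnertonDyer.Rank1Residual.X1.MuLambda
  Summit.BirchSwinnertonDyer.Rank1Residual.X1.MuPart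
  Summit.BirchSwinnertonDyer.Rank1Residual.X1.ParitySqueeze
  Summit.BirchSwinnertonDyer.Rank1Residual.X1.TamagawaSqueeze
  Summit.BirchSwinnertonDyer.Rank1Residual.X1.ResidualDescent
  Summit.BirchSwinnertonDyer.Rank1Residual.X1.FactorSqueeze
  Summit.BirchSwinnertonDyer.Rank1Residual.X1.EisensteinSqueeze
  Summit.BirchSwinnertonDyer.Rank1Residual.X1.RankOneLeadingTermSqueeze

set_option autoImplicit false

namespace Summit.BirchSwinnertonDyer.Rank1Residual.X1.RankOneFactorSqueeze

/-! ## §1. "every `Λ`-divisor of `ϖ·L_p` vanishing at `T = 0` has `λ` in `A`", TYPED; Eisenstein discharge -/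

/-- **"`λ(g) ∈ A` for every `Λ`-divisor `g` of `ϖ·L_p(E,T)` with `g(0) = 0`" (TYPED; nothing asserted).**
For the newform `f` of `E`, every rational `ϖ` with `ϖ·Ω_E = Ω⁺_f` and all `g, h ∈ Λ` with
`ι(g·h) = ϖ·L_p(f,α)` AND `g(0) = 0`: `λ(g) ∈ A`. CERTIFICATE (outside the kernel): at a rank-one pair
`P_an = T·P'`; the distinguished polynomial of such a `g` is `T·Q` with `Q ∣ P'` in `ℚ_p[T]`, so
`λ(g) − 1` is a subset sum of the degrees of the `ℚ_p`-irreducible factors of `P'` — computed per pair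
from the Newton polygon of `(ϖ·L_p)/T` and Ore's residual polynomials (eisenstein-p1's pattern engine
N1b on the shifted coefficients `c₁, …, c_{λ_an}`). Any `A ⊇ {1 + those sums}` qualifies; every
`AnalyticLamDivisorSet W p A` qualifies (`.of_lamDivisorSet`).
[cite: Washington1997, Thm. 7.3 and Prop. 7.6 (shape only; nothing asserted)] -/
def AnalyticLamDivisorSetT (W : WeierstrassCurve ℚ) [W.IsElliptic] [W.IsGloballyMinimal] (p : ℕ)
    [Fact p.Prime] (A : Set ℕ) : Prop :=
  ∀ [NeZero (W.conductorNorm ℤ)] (f : CuspForm (Gamma0 (W.conductorNorm ℤ)) 2),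
    IsNewformOf W f → ∀ (ϖ : ℚ), (ϖ : ℝ) * W.realPeriodRat = plusPeriod f →
    ∀ (g h : IwasawaAlgebra p),
      iwasawaToPowerSeries p (g * h) = C (ϖ : ℚ_[p]) * padicLFunction f (unitRoot W p : ℚ_[p]) →
      constantCoeff g = 0 → lam g ∈ A

section Basic

variable {W : WeierstrassCurve ℚ} [W.IsElliptic] [W.IsGloballyMinimal] {p : ℕ} [Fact p.Prime]

/-- `AnalyticLamDivisorSetT` is monotone in the set. [folklore] -/
theorem AnalyticLamDivisorSetT.mono {A B : Set ℕ} (hAB : A ⊆ B) (hA : AnalyticLamDivisorSetT W p A) :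
    AnalyticLamDivisorSetT W p B :=
  fun f hf ϖ hϖ g h hι h0 ↦ hAB (hA f hf ϖ hϖ g h hι h0)

/-- Route N's unrestricted divisor set qualifies: `AnalyticLamDivisorSet W p A → AnalyticLamDivisorSetT W p A`.
[folklore] -/
theorem AnalyticLamDivisorSetT.of_lamDivisorSet {A : Set ℕ} (hA : AnalyticLamDivisorSet W p A) :
    AnalyticLamDivisorSetT W p A :=
  fun f hf ϖ hϖ g h hι _ ↦ hA f hf ϖ hϖ g h hι

/-- **Eisenstein `P'` ⇒ `AnalyticLamDivisorSetT W p {1, n}` (PROVED, no Weierstrass preparation).** If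
`λ_an(E,p) = n` and `ord_p [T¹](ϖ·L_p) = 1` (`AnalyticCoeffOneVal W p 1`), every `Λ`-divisor `g` of
`ϖ·L_p` with `g(0) = 0` has `λ(g) ∈ {1, n}`: the leading-term dichotomy
(`RankOneLeadingTermSqueeze.lam_eq_one_or_isUnit_of_valuation_coeff_one_mul_eq_one`) gives `λ(g) = 1` or
`h ∈ Λˣ`, `λ(g) = λ(g·h) = n`. [cite: GreenbergLNM1716, §5 p. 131] [cite: Washington1997, §7.1] -/
theorem analyticLamDivisorSetT_pair_of_coeffOneVal_one {n : ℕ} (hlam : AnalyticLambdaEq W p n)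
    (hc : RankOneLeadingTermSqueeze.AnalyticCoeffOneVal W p 1) : AnalyticLamDivisorSetT W p {1, n} := by
  intro _ f hf ϖ hϖ g h hι h0
  have hv : ((coeff 1 (g * h) : ℤ_[p]) : ℚ_[p]).valuation = 1 := hc.valuation_coeff_one_eq hf hϖ hι
  have hn : lam (g * h) = n := hlam f hf ϖ hϖ (g * h) hι
  rcases RankOneLeadingTermSqueeze.lam_eq_one_or_isUnit_of_valuation_coeff_one_mul_eq_one h0 hv with
    h1 | hunit
  · exact Or.inl h1
  · right
    have hne : g * h ≠ 0 := by
      intro e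
      rw [e, map_zero, PadicInt.coe_zero, Padic.valuation_zero] at hv
      exact zero_ne_one hv
    have hg : g ≠ 0 := fun e ↦ hne (by rw [e, zero_mul])
    rw [Set.mem_singleton_iff, ← hn, lam_mul hg hunit.ne_zero, lam_eq_zero_of_isUnit hunit, add_zero]

end Basic

/-! ## §2. Route N at Selmer corank `1`: the λ-part from a divisor-degree gap with ODD parity -/

section Squeeze

variable {W : WeierstrassCurve ℚ} [W.IsElliptic] [W.IsGloballyMinimal] {p : ℕ} [Fact p.Prime]

/-- **Route N at rank one, λ-part with ODD parity.** `W/ℚ` globally minimal elliptic, `p ≠ 2` good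
ordinary with `E[p]` reducible, `rank E(ℚ) ≥ 1`, `corank_{ℤ_p} Sel_{p^∞}(E/ℚ) = 1`; granted Wuthrich
Thm. 16 (`hW16`), Greenberg Prop. 3.10 (`h310`), BMS Thm. 1.7 (1) (`hS`) and Mazur–Tate (`hMT`), all
PUBLISHED: if `λ_an = n` is ODD, every `Λ`-divisor of `ϖ·L_p` vanishing at `0` has `λ ∈ A`
(`AnalyticLamDivisorSetT W p A`), `λ_alg ≥ k` and the GAP CHECK `∀ d ∈ A, Odd d → k ≤ d → n ≤ d + 1`
passes, then `LambdaPartAt W p`: `f_E(0) = 0`, `λ(f_E) ∈ A` is odd and `≥ k`, so `n ≤ λ(f_E) + 1`, and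
`n`, `λ(f_E)` both odd force `n ≤ λ(f_E)`. [cite: Washington1997, Thm. 7.3 and Prop. 7.6]
[cite: GreenbergLNM1716, Prop. 3.10] [cite: BalakrishnanMullerStein2015, Thm. 1.7 (1)]
[cite: Wuthrich2014, Thm. 16 (p. 397)] -/
theorem lambdaPartAt_of_lamDivisorSetT_of_odd (hW16 : Wuthrich2014.charIdeal_dvd_padicLFunction)
    (h310 : prop310_selmerCorank_mod_two_eq_lambdaInvariant) (hS : Schneider1985_order_charGenerator_odd)
    (hMT : mazur_tate_sigma_exists_odd) (hp : p ≠ 2) (hgood : W.HasGoodReductionAtPrime p)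
    (hord : ¬ (p : ℤ) ∣ W.frobeniusTrace p) (hred : ¬ W.HasIrreducibleModPGaloisRep p)
    (hrk : 1 ≤ W.mordellWeilRank) (hcork : W.selmerCorank p = 1) {n k : ℕ} {A : Set ℕ} (hn : Odd n)
    (hlam : AnalyticLambdaEq W p n) (hA : AnalyticLamDivisorSetT W p A) (hk : AlgebraicLambdaGE W p k)
    (hgap : ∀ d ∈ A, Odd d → k ≤ d → n ≤ d + 1) : LambdaPartAt W p := by
  intro κ γ hκ hγ hγ' _ f hf ϖ hϖ D g h hchar hι
  haveI : Module.Finite (IwasawaAlgebra p) D.X := D.module_finite_holds hγ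
  obtain ⟨hX, -⟩ := hW16 W p hp ⟨hgood, hord⟩ hred hκ hγ hγ' hf D ϖ hϖ
  have hgh : g * h ≠ 0 := mul_ne_zero_of_iota_eq hgood hord hf hϖ D hι
  have hg : g ≠ 0 := fun h0 ↦ hgh (by rw [h0, zero_mul])
  have h1 : lam (g * h) = n := hlam f hf ϖ hϖ (g * h) hι
  have h2 : lam g = lambdaInvariant p D.X := lam_generator_eq_lambdaInvariant D.X hX hg hchar
  have h3 : k ≤ lambdaInvariant p D.X := hk κ γ hκ hγ D hX
  have hg0 : constantCoeff g = 0 :=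
    RankOneLeadingTermSqueeze.constantCoeff_charGenerator_eq_zero hS hMT hp hgood hord hrk hκ hγ hγ' D hX
      hchar
  have hodd : Odd (lam g) := by
    rw [h2]
    exact prop310_selmerCorank_mod_two_eq_lambdaInvariant.odd_lambdaInvariant_of_selmerCorank_eq_one
      h310 W p hp hκ hγ D hX hcork
  have h4 : lam g ∈ A := hA f hf ϖ hϖ g h hι hg0
  have h5 : n ≤ lam g + 1 := hgap (lam g) h4 hodd (by omega)
  obtain ⟨a, ha⟩ := hodd
  obtain ⟨b, hb⟩ := hn
  omega

/-- **Route N at rank one fed by route D.** As `lambdaPartAt_of_lamDivisorSetT_of_odd`, the lower bound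
being eisenstein-p1's `ResidualDescentBound W p k e` (`k ≤ λ(X) + e` at `μ(X) = 0`, from `μ_an = 0`), gap
check `∀ d ∈ A, Odd d → k ≤ d + e → n ≤ d + 1`.
[cite: GreenbergVatsal2000, §2 Prop. (2.8), Cor. (2.3), Prop. (2.4), pp. 25–27]
[cite: GreenbergLNM1716, Prop. 3.10] [cite: Wuthrich2014, Thm. 16 (p. 397)] -/
theorem lambdaPartAt_of_lamDivisorSetT_of_residualDescent_of_odd
    (hW16 : Wuthrich2014.charIdeal_dvd_padicLFunction) (hmod : nonempty_modularParametrizationData)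
    (h310 : prop310_selmerCorank_mod_two_eq_lambdaInvariant) (hS : Schneider1985_order_charGenerator_odd)
    (hMT : mazur_tate_sigma_exists_odd) (hp : p ≠ 2) (hgood : W.HasGoodReductionAtPrime p)
    (hord : ¬ (p : ℤ) ∣ W.frobeniusTrace p) (hred : ¬ W.HasIrreducibleModPGaloisRep p)
    (hrk : 1 ≤ W.mordellWeilRank) (hcork : W.selmerCorank p = 1) (hμ0 : AnalyticMuLE W p 0)
    {n k e : ℕ} {A : Set ℕ} (hn : Odd n) (hlam : AnalyticLambdaEq W p n)
    (hA : AnalyticLamDivisorSetT W p A) (hD : ResidualDescentBound W p k e)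
    (hgap : ∀ d ∈ A, Odd d → k ≤ d + e → n ≤ d + 1) : LambdaPartAt W p := by
  intro κ γ hκ hγ hγ' _ f hf ϖ hϖ D g h hchar hι
  haveI : Module.Finite (IwasawaAlgebra p) D.X := D.module_finite_holds hγ
  obtain ⟨hX, h3⟩ := ResidualDescent.isTorsion_and_le_lambdaInvariant_of_residualDescentBound hW16 hmod
    hp hgood hord hred hμ0 hD hκ hγ hγ' D
  have hgh : g * h ≠ 0 := mul_ne_zero_of_iota_eq hgood hord hf hϖ D hι
  have hg : g ≠ 0 := fun h0 ↦ hgh (by rw [h0, zero_mul])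
  have h1 : lam (g * h) = n := hlam f hf ϖ hϖ (g * h) hι
  have h2 : lam g = lambdaInvariant p D.X := lam_generator_eq_lambdaInvariant D.X hX hg hchar
  have hg0 : constantCoeff g = 0 :=
    RankOneLeadingTermSqueeze.constantCoeff_charGenerator_eq_zero hS hMT hp hgood hord hrk hκ hγ hγ' D hX
      hchar
  have hodd : Odd (lam g) := by
    rw [h2]
    exact prop310_selmerCorank_mod_two_eq_lambdaInvariant.odd_lambdaInvariant_of_selmerCorank_eq_one
      h310 W p hp hκ hγ D hX hcork
  have h4 : lam g ∈ A := hA f hf ϖ hϖ g h hι hg0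
  have h5 : n ≤ lam g + 1 := hgap (lam g) h4 hodd (by omega)
  obtain ⟨a, ha⟩ := hodd
  obtain ⟨b, hb⟩ := hn
  omega

end Squeeze

/-! ## §3. On the rank-one leaf X1 ∩ {r = 1}: route N closes Mazur's MC; + certificate ⇒ `BSD(E,p)` -/

section Leaf

variable {W : WeierstrassCurve ℚ} [W.IsElliptic] [W.IsGloballyMinimal] {p : ℕ} [Fact p.Prime]

/-- **Route N on the rank-one leaf: Mazur's main conjecture at `E₀`** from `μ_an(E₀) = 0` (μ-part by
Kato–Wuthrich), `λ_an = n`, the `T`-divisor set `A`, `λ_alg ≥ k` and the odd gap check — parity automatic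
on the leaf (`λ_an` odd: MTT, x1b's `RankOne.Leaf.odd_of_analyticLambdaEq`; `λ(f_E)` odd: Prop. 3.10 at
corank `1`; rank `1` by GZK). Facts `hW16 h310 hS hMT hmod hGZK` all PUBLISHED.
[cite: Washington1997, Thm. 7.3 and Prop. 7.6] [cite: GreenbergLNM1716, Prop. 3.10]
[cite: Wuthrich2014, Thm. 16 (p. 397)] [cite: MazurTateTeitelbaum1986Invent, §I.17–I.18] -/
theorem _root_.Summit.BirchSwinnertonDyer.Rank1Residual.X1.RankOne.Leaf.mazurMainConjecture_of_muZero_of_lamDivisorSetT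
    (hW16 : Wuthrich2014.charIdeal_dvd_padicLFunction)
    (h310 : prop310_selmerCorank_mod_two_eq_lambdaInvariant) (hS : Schneider1985_order_charGenerator_odd)
    (hMT : mazur_tate_sigma_exists_odd) (hmod : nonempty_modularParametrizationData)
    (hGZK : rank_eq_analyticRank_of_analyticRank_le_one) (hL : RankOne.Leaf W p)
    (hμ0 : AnalyticMuLE W p 0) {n k : ℕ} {A : Set ℕ} (hlam : AnalyticLambdaEq W p n)
    (hA : AnalyticLamDivisorSetT W p A) (hk : AlgebraicLambdaGE W p k)
    (hgap : ∀ d ∈ A, Odd d → k ≤ d → n ≤ d + 1) : MazurMainConjecture W p :=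
  have hX := isClassX1_of_classX1 hL.1
  (mazurMainConjecture_iff_muPart_and_lambdaPart hW16 hX.two_ne hX.hasGoodReductionAtPrime
      hX.not_dvd_frobeniusTrace hX.not_hasIrreducibleModPGaloisRep).mpr
    ⟨muPartAt_of_analyticMuLE_zero hW16 hX.two_ne hX.hasGoodReductionAtPrime hX.not_dvd_frobeniusTrace
        hX.not_hasIrreducibleModPGaloisRep hμ0,
      lambdaPartAt_of_lamDivisorSetT_of_odd hW16 h310 hS hMT hX.two_ne hX.hasGoodReductionAtPrime
        hX.not_dvd_frobeniusTrace hX.not_hasIrreducibleModPGaloisRep (by rw [hL.mordellWeilRank_eq_one hGZK])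
        (hL.selmerCorank_eq_one hGZK) (hL.odd_of_analyticLambdaEq hW16 hmod hlam) hlam hA hk hgap⟩

/-- **Route N fed by route D on the rank-one leaf: `μ_an = 0 ∧ λ_an = n ∧ AnalyticLamDivisorSetT A ∧
ResidualDescentBound k e ∧ (∀ d ∈ A, Odd d → k ≤ d + e → n ≤ d + 1) ⇒` Mazur's MC.**
[cite: GreenbergVatsal2000, §2 pp. 25–27] [cite: GreenbergLNM1716, Prop. 3.10]
[cite: Wuthrich2014, Thm. 16 (p. 397)] [cite: Washington1997, Thm. 7.3 and Prop. 7.6] -/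
theorem _root_.Summit.BirchSwinnertonDyer.Rank1Residual.X1.RankOne.Leaf.mazurMainConjecture_of_muZero_of_lamDivisorSetT_of_residualDescent
    (hW16 : Wuthrich2014.charIdeal_dvd_padicLFunction)
    (h310 : prop310_selmerCorank_mod_two_eq_lambdaInvariant) (hS : Schneider1985_order_charGenerator_odd)
    (hMT : mazur_tate_sigma_exists_odd) (hmod : nonempty_modularParametrizationData)
    (hGZK : rank_eq_analyticRank_of_analyticRank_le_one) (hL : RankOne.Leaf W p)
    (hμ0 : AnalyticMuLE W p 0) {n k e : ℕ} {A : Set ℕ} (hlam : AnalyticLambdaEq W p n)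
    (hA : AnalyticLamDivisorSetT W p A) (hD : ResidualDescentBound W p k e)
    (hgap : ∀ d ∈ A, Odd d → k ≤ d + e → n ≤ d + 1) : MazurMainConjecture W p :=
  have hX := isClassX1_of_classX1 hL.1
  (mazurMainConjecture_iff_muPart_and_lambdaPart hW16 hX.two_ne hX.hasGoodReductionAtPrime
      hX.not_dvd_frobeniusTrace hX.not_hasIrreducibleModPGaloisRep).mpr
    ⟨muPartAt_of_analyticMuLE_zero hW16 hX.two_ne hX.hasGoodReductionAtPrime hX.not_dvd_frobeniusTrace
        hX.not_hasIrreducibleModPGaloisRep hμ0,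
      lambdaPartAt_of_lamDivisorSetT_of_residualDescent_of_odd hW16 hmod h310 hS hMT hX.two_ne
        hX.hasGoodReductionAtPrime hX.not_dvd_frobeniusTrace hX.not_hasIrreducibleModPGaloisRep
        (by rw [hL.mordellWeilRank_eq_one hGZK]) (hL.selmerCorank_eq_one hGZK) hμ0
        (hL.odd_of_analyticLambdaEq hW16 hmod hlam) hlam hA hD hgap⟩

/-- **Route N in certificate currency on the rank-one leaf: `μ_an = 0 ∧ λ_an = n ∧ AnalyticLamDivisorSetT A ∧
λ_alg ≥ k ∧ gap` + `[T¹]L_p(f,α,T) ≠ 0` (for SOME newform `f` of `E₀`) ⇒ Mazur's MC ∧ `BSD(E₀,p)`**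
(x1a's converter `RankOne.Leaf.schneider_of_coeff_one_ne_zero` and `…bsdp_of_mazurMainConjecture_of_schneider`;
Perrin-Riou–Schneider, Perrin-Riou 1987, Mazur–Tate `σ`, modularity, GZK). No `#Ш(E/ℚ)_an`.
[cite: Washington1997, Thm. 7.3 and Prop. 7.6] [cite: Wuthrich2014, Thm. 16 (p. 397)]
[cite: BalakrishnanMullerStein2015, Thm. 1.7] [cite: PerrinRiou1987, §1.4 Cor. 1.8] -/
theorem _root_.Summit.BirchSwinnertonDyer.Rank1Residual.X1.RankOne.Leaf.mazurMainConjecture_and_bsdp_of_muZero_of_lamDivisorSetT_of_coeff_one_ne_zero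
    (hW16 : Wuthrich2014.charIdeal_dvd_padicLFunction)
    (h310 : prop310_selmerCorank_mod_two_eq_lambdaInvariant) (hS : Schneider1985_order_charGenerator_odd)
    (hPR : perrinRiou_rankOne_leadingTerms_odd) (hMT : mazur_tate_sigma_exists_odd)
    (hmod : nonempty_modularParametrizationData) (hGZK : rank_eq_analyticRank_of_analyticRank_le_one)
    (hL : RankOne.Leaf W p) (hμ0 : AnalyticMuLE W p 0) {n k : ℕ} {A : Set ℕ}
    (hlam : AnalyticLambdaEq W p n) (hA : AnalyticLamDivisorSetT W p A) (hk : AlgebraicLambdaGE W p k)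
    (hgap : ∀ d ∈ A, Odd d → k ≤ d → n ≤ d + 1)
    {N : ℕ} [NeZero N] (f : CuspForm (Gamma0 N) 2) (hf : IsNewformOf W f)
    (hcoeff : coeff 1 (padicLFunction f (unitRoot W p : ℚ_[p])) ≠ 0) :
    MazurMainConjecture W p ∧ BSDp W p :=
  have hMC : MazurMainConjecture W p :=
    hL.mazurMainConjecture_of_muZero_of_lamDivisorSetT hW16 h310 hS hMT hmod hGZK hμ0 hlam hA hk hgap
  ⟨hMC, hL.bsdp_of_mazurMainConjecture_of_schneider hS hPR hMT hmod hGZK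
    (hL.schneider_of_coeff_one_ne_zero hPR hGZK f hf hcoeff) hMC⟩

/-- **Consistency on the rank-one leaf (the census's falsification test): a certified `T`-divisor set
contains an ODD `d` with `k ≤ d ≤ λ_an`** — namely `d = λ(f_E)` (the data exist: modularity, `κ, γ`, a
dual datum; `ϖ·L_p = ι(f_E·h)`, `f_E(0) = 0`). [cite: Wuthrich2014, Thm. 16 (p. 397)]
[cite: GreenbergLNM1716, Prop. 3.10] [cite: BalakrishnanMullerStein2015, Thm. 1.7 (1)] -/
theorem _root_.Summit.BirchSwinnertonDyer.Rank1Residual.X1.RankOne.Leaf.exists_mem_of_lamDivisorSetT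
    (hW16 : Wuthrich2014.charIdeal_dvd_padicLFunction)
    (h310 : prop310_selmerCorank_mod_two_eq_lambdaInvariant) (hS : Schneider1985_order_charGenerator_odd)
    (hMT : mazur_tate_sigma_exists_odd) (hmod : nonempty_modularParametrizationData)
    (hGZK : rank_eq_analyticRank_of_analyticRank_le_one) (hL : RankOne.Leaf W p) {n k : ℕ} {A : Set ℕ}
    (hk : AlgebraicLambdaGE W p k) (hn : AnalyticLambdaEq W p n) (hA : AnalyticLamDivisorSetT W p A) :
    ∃ d ∈ A, Odd d ∧ k ≤ d ∧ d ≤ n := by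
  have hX := isClassX1_of_classX1 hL.1
  haveI : NeZero (W.conductorNorm ℤ) := ⟨(W.conductorNorm_pos_holds).ne'⟩
  obtain ⟨κ, hκ, γ, hγ, hγ'⟩ := exists_isCyclotomic_isTopGenerator_isCyclotomicVariable_holds p
  obtain ⟨D⟩ := W.nonempty_selmerDualData_holds κ γ hγ
  haveI : Module.Finite (IwasawaAlgebra p) D.X := D.module_finite_holds hγ
  obtain ⟨hXt, f, ϖ, g, h, hf, hϖ, hchar, hι⟩ := isTorsion_and_exists_factorisation hW16 hmod
    hX.two_ne hX.hasGoodReductionAtPrime hX.not_dvd_frobeniusTrace hX.not_hasIrreducibleModPGaloisRep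
    hκ hγ hγ' D
  have hgh : g * h ≠ 0 :=
    mul_ne_zero_of_iota_eq hX.hasGoodReductionAtPrime hX.not_dvd_frobeniusTrace hf hϖ D hι
  have hg0 : g ≠ 0 := fun h0 ↦ hgh (by rw [h0, zero_mul])
  have hh0 : h ≠ 0 := fun h0 ↦ hgh (by rw [h0, mul_zero])
  have h1 : lam (g * h) = n := hn f hf ϖ hϖ (g * h) hι
  have h2 : lam g = lambdaInvariant p D.X := lam_generator_eq_lambdaInvariant D.X hXt hg0 hchar
  have h3 : k ≤ lambdaInvariant p D.X := hk κ γ hκ hγ D hXt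
  have h4 : lam g ≤ lam (g * h) := lam_le_lam_mul hg0 hh0
  have hg00 : constantCoeff g = 0 :=
    RankOneLeadingTermSqueeze.constantCoeff_charGenerator_eq_zero hS hMT hX.two_ne
      hX.hasGoodReductionAtPrime hX.not_dvd_frobeniusTrace (by rw [hL.mordellWeilRank_eq_one hGZK])
      hκ hγ hγ' D hXt hchar
  have hodd : Odd (lam g) := by
    rw [h2]
    exact prop310_selmerCorank_mod_two_eq_lambdaInvariant.odd_lambdaInvariant_of_selmerCorank_eq_one
      h310 W p hX.two_ne hκ hγ D hXt (hL.selmerCorank_eq_one hGZK)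
  exact ⟨lam g, hA f hf ϖ hϖ g h hι hg00, hodd, by omega, by omega⟩

end Leaf

/-! ## §4. Route E (`ord_p c₁ = 1`) on the rank-one leaf fed by route D and by an isogenous member -/

section RouteE

variable {W W' : WeierstrassCurve ℚ} [W.IsElliptic] [W.IsGloballyMinimal]
  [W'.IsElliptic] [W'.IsGloballyMinimal] {p : ℕ} [Fact p.Prime]

/-- **Route E fed by route D on the rank-one leaf: `ord_p c₁ = 1 ∧ μ_an(E) = 0 ∧
dim Sel_m(E[p]/ℚ_m) = k ≤ λ_alg + e ∧ e + 2 ≤ k ⇒` Mazur's MC `∧ BSD(E,p)`** (lower bound = sub-cell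
eisenstein-p1's residual-descent witnesses `ResidualDescentBound W p k e`, GRH-free S₃-descent certificates
of the census; `RankOneLeadingTermSqueeze.isTorsion_and_exists_charIdeal_eq_of_coeffOneVal_one`).
[cite: GreenbergVatsal2000, §2 Prop. (2.8), Cor. (2.3), Prop. (2.4), pp. 25–27]
[cite: BalakrishnanMullerStein2015, Thm. 1.7] [cite: Wuthrich2014, Thm. 16 (p. 397)]
[cite: PerrinRiou1987, §1.4 Cor. 1.8] -/
theorem _root_.Summit.BirchSwinnertonDyer.Rank1Residual.X1.RankOne.Leaf.mazurMainConjecture_and_bsdp_of_coeffOneVal_one_of_residualDescent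
    (hW16 : Wuthrich2014.charIdeal_dvd_padicLFunction) (hS : Schneider1985_order_charGenerator_odd)
    (hPR : perrinRiou_rankOne_leadingTerms_odd) (hMT : mazur_tate_sigma_exists_odd)
    (hmod : nonempty_modularParametrizationData) (hGZK : rank_eq_analyticRank_of_analyticRank_le_one)
    (hL : RankOne.Leaf W p) (hc : RankOneLeadingTermSqueeze.AnalyticCoeffOneVal W p 1)
    (hμ0 : AnalyticMuLE W p 0) {k e : ℕ} (hD : ResidualDescentBound W p k e) (hke : e + 2 ≤ k) :
    MazurMainConjecture W p ∧ BSDp W p := by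
  have hX := isClassX1_of_classX1 hL.1
  have hMC : MazurMainConjecture W p := by
    intro κ γ hκ hγ hγ' _ f hf ϖ hϖ D
    haveI : Module.Finite (IwasawaAlgebra p) D.X := D.module_finite_holds hγ
    refine RankOneLeadingTermSqueeze.isTorsion_and_exists_charIdeal_eq_of_coeffOneVal_one hW16 hS hMT
      hX.two_ne hX.hasGoodReductionAtPrime hX.not_dvd_frobeniusTrace hX.not_hasIrreducibleModPGaloisRep
      (by rw [hL.mordellWeilRank_eq_one hGZK]) hc hκ hγ hγ' hf hϖ D (fun _ ↦ ?_)
    obtain ⟨-, h3⟩ := ResidualDescent.isTorsion_and_le_lambdaInvariant_of_residualDescentBound hW16 hmod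
      hX.two_ne hX.hasGoodReductionAtPrime hX.not_dvd_frobeniusTrace hX.not_hasIrreducibleModPGaloisRep
      hμ0 hD hκ hγ hγ' D
    omega
  exact ⟨hMC, hL.bsdp_of_mazurMainConjecture_of_schneider hS hPR hMT hmod hGZK
    (hL.schneider_of_coeffOneVal hPR hGZK hmod hc one_ne_zero) hMC⟩

/-- **Route E with the lower bound TRANSPORTED from an isogenous curve** (the `λ`-invariant of
`X(E/ℚ_∞)` is an isogeny invariant — KERNEL theorem `X2.IsogenyLambdaInvariant.lambdaInvariant_eq_of_isIsogenous`,
sub-cell eisenstein-p2; `μ` is not): on the rank-one leaf, `ord_p c₁(E) = 1` at `E` and `λ_alg(E') ≥ 2` at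
an isogenous `E'` in class X1 at `p` (e.g. Kundu–Ray at the member WITHOUT rational `p`-torsion while `E`
is the `μ = 0` member WITH it; `X(E')` torsion by Kato–Wuthrich) ⇒ Mazur's MC `∧ BSD(E,p)` at `E`.
[cite: GreenbergVatsal2000, §2 p. 28 ("The λ-invariant is always unchanged by an isogeny")]
[cite: BalakrishnanMullerStein2015, Thm. 1.7] [cite: Wuthrich2014, Thm. 16 (p. 397)]
[cite: PerrinRiou1987, §1.4 Cor. 1.8] -/
theorem _root_.Summit.BirchSwinnertonDyer.Rank1Residual.X1.RankOne.Leaf.mazurMainConjecture_and_bsdp_of_coeffOneVal_one_of_isIsogenous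
    (hW16 : Wuthrich2014.charIdeal_dvd_padicLFunction) (hS : Schneider1985_order_charGenerator_odd)
    (hPR : perrinRiou_rankOne_leadingTerms_odd) (hMT : mazur_tate_sigma_exists_odd)
    (hmod : nonempty_modularParametrizationData) (hGZK : rank_eq_analyticRank_of_analyticRank_le_one)
    (hL : RankOne.Leaf W p) (hc : RankOneLeadingTermSqueeze.AnalyticCoeffOneVal W p 1)
    (hiso : WeierstrassCurve.IsIsogenous W W') (hX1' : ClassX1 W' p) (hk' : AlgebraicLambdaGE W' p 2) :
    MazurMainConjecture W p ∧ BSDp W p := by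
  have hX := isClassX1_of_classX1 hL.1
  have hX' := isClassX1_of_classX1 hX1'
  have hMC : MazurMainConjecture W p := by
    intro κ γ hκ hγ hγ' _ f hf ϖ hϖ D
    haveI : Module.Finite (IwasawaAlgebra p) D.X := D.module_finite_holds hγ
    refine RankOneLeadingTermSqueeze.isTorsion_and_exists_charIdeal_eq_of_coeffOneVal_one hW16 hS hMT
      hX.two_ne hX.hasGoodReductionAtPrime hX.not_dvd_frobeniusTrace hX.not_hasIrreducibleModPGaloisRep
      (by rw [hL.mordellWeilRank_eq_one hGZK]) hc hκ hγ hγ' hf hϖ D (fun _ ↦ ?_)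
    haveI : NeZero (W'.conductorNorm ℤ) := ⟨(W'.conductorNorm_pos_holds).ne'⟩
    obtain ⟨D'⟩ := W'.nonempty_selmerDualData_holds κ γ hγ
    haveI : Module.Finite (IwasawaAlgebra p) D'.X := D'.module_finite_holds hγ
    obtain ⟨hX'T, -⟩ := isTorsion_and_exists_factorisation hW16 hmod hX'.two_ne
      hX'.hasGoodReductionAtPrime hX'.not_dvd_frobeniusTrace hX'.not_hasIrreducibleModPGaloisRep hκ hγ hγ' D'
    rw [X2.IsogenyLambdaInvariant.lambdaInvariant_eq_of_isIsogenous hiso D D']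
    exact hk' κ γ hκ hγ D' hX'T
  exact ⟨hMC, hL.bsdp_of_mazurMainConjecture_of_schneider hS hPR hMT hmod hGZK
    (hL.schneider_of_coeffOneVal hPR hGZK hmod hc one_ne_zero) hMC⟩

end RouteE

end Summit.BirchSwinnertonDyer.Rank1Residual.X1.RankOneFactorSqueeze

end
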